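import Literature.AlgebraicGeometry.AbelianSchemes.AbelianSchemePolarization
import Literature.AlgebraicGeometry.AbelianSchemes.AbelianSchemeDualPairBaseChange
import HarnessLib

/-!
# The `𝒫`-slice dictionary of a dual pair: «`λ̄₂(Q₂) = λ̄₁(Q₁)` ↔ the `𝒫`-slices are isomorphic»

For an abelian scheme `A/S` with a dual pair `D = (Â, 𝒫)` ([MFK] Def. 6.2) and a geometric point `s : Spec Ω ⟶ S`:
the slice `sliceBundle b s hs` of the Poincaré bundle over `A_s × {b}` is a rigidified line bundle in `Pic⁰`
(`sliceBundle_fibrewisePicZero`), and two values `A.valueAt s D lamᵢ Qᵢ` of homomorphisms `lamᵢ : A ⟶ Â` at points `Qᵢ`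
coincide iff the corresponding `𝒫`-slices are isomorphic (`valueAt_eq_iff_nonempty_slice_iso`) — and, when `lamᵢ = Λ(Θᵢ)`
at `s` (`IsLambdaOfAt`), iff the Mumford bundles `t_{Qᵢ}^* L(Θᵢ) ⊗ L(Θᵢ)⁻¹` are isomorphic
(`valueAt_eq_iff_nonempty_iso_of_isLambdaOfAt`).  The test bundle is `𝒫`'s OWN slice, so no theorem of the square is
used.  This is the (c-ii) dictionary, part (D-1′)/(D-1), of the W3c transport step of the Siegel canonical-model route
(author B-p01 (g9); filed by import over ★ `AbelianSchemeDualPairBaseChange` by the (D-1) courier).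
-/


set_option autoImplicit false

universe u

open CategoryTheory CategoryTheory.Limits AlgebraicGeometry MonoidalCategory

noncomputable section

namespace Literature.AlgebraicGeometry.AbelianSchemes

namespace AbelianSchemeOver

namespace DualPair

open Literature.AlgebraicGeometry.Motives Literature.AlgebraicGeometry.AbelianVarieties Literature.AlgebraicGeometry.Modules
open scoped MonObj

variable {S : Scheme.{u}} {A : AbelianSchemeOver S} (D : A.DualPair) {Ω : Type u} [Field Ω]

/-- The slice of [MFK] Def. 6.2 at `λ̄(P)` IS the fibre slice over the presentation `s` of its base point (same
`pullback.lift`). [cite: MumfordFogartyKirwan1994, Ch. 6 §2 Definition 6.2 (p. 120)] -/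
theorem sliceAt_eq_sliceOver (s : Spec (.of Ω) ⟶ S) (lam : A.X ⟶ D.hat.X)
    (P : (A.fibre s).toAbelianVariety.Points Ω) :
    A.sliceAt s D lam P = D.sliceOver (A.valueAt s D lam P) s (A.valueAt_comp_hom s D lam P) := rfl

/-- `(1 × b)^*𝒫` over a point is `𝒫` pulled back along the slice (same `pullback.lift`). [cite: MilneAV2008, I §8 pp. 36–37] -/
theorem pullbackP_eq_pullback_sliceOver (b : Spec (.of Ω) ⟶ D.hat.X.left) (s : Spec (.of Ω) ⟶ S)
    (hs : b ≫ D.hat.X.hom = s) :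
    D.pullbackP s b hs = (Scheme.Modules.pullback (D.sliceOver b s hs)).obj D.P := rfl

/-- The identity section of the fibre `A_s` lands in the slice at `(e, b)`: `ε_{A_s} ≫ (a ↦ (a,b)) = b ≫ (ε_A × 1)`.
[cite: MumfordFogartyKirwan1994, Ch. 6 §2 (p. 121)] -/
@[reassoc]
theorem unitSection_baseChange_comp_sliceOver (b : Spec (.of Ω) ⟶ D.hat.X.left) (s : Spec (.of Ω) ⟶ S)
    (hs : b ≫ D.hat.X.hom = s) :
    (A.baseChange s).unitSection ≫ D.sliceOver b s hs = b ≫ A.unitSlice D.hat := by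
  have hsec : (A.baseChange s).unitSection ≫ pullback.snd A.X.hom s = 𝟙 _ :=
    (A.baseChange s).unitSection_comp_hom
  apply pullback.hom_ext
  · calc ((A.baseChange s).unitSection ≫ D.sliceOver b s hs) ≫ pullback.fst A.X.hom D.hat.X.hom
          = (A.baseChange s).unitSection ≫ (D.sliceOver b s hs ≫ pullback.fst A.X.hom D.hat.X.hom) :=
            Category.assoc _ _ _
      _ = (A.baseChange s).unitSection ≫ pullback.fst A.X.hom s :=
            congrArg (fun x => (A.baseChange s).unitSection ≫ x) (D.sliceOver_fst b s hs)
      _ = s ≫ A.unitSection := unitSection_baseChange_comp_fst A s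
      _ = (b ≫ D.hat.X.hom) ≫ A.unitSection := by rw [hs]
      _ = b ≫ (D.hat.X.hom ≫ A.unitSection) := Category.assoc _ _ _
      _ = b ≫ (A.unitSlice D.hat ≫ pullback.fst A.X.hom D.hat.X.hom) :=
            congrArg (fun x => b ≫ x) (A.unitSlice_fst D.hat).symm
      _ = (b ≫ A.unitSlice D.hat) ≫ pullback.fst A.X.hom D.hat.X.hom := (Category.assoc _ _ _).symm
  · calc ((A.baseChange s).unitSection ≫ D.sliceOver b s hs) ≫ pullback.snd A.X.hom D.hat.X.hom
          = (A.baseChange s).unitSection ≫ (D.sliceOver b s hs ≫ pullback.snd A.X.hom D.hat.X.hom) :=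
            Category.assoc _ _ _
      _ = (A.baseChange s).unitSection ≫ (pullback.snd A.X.hom s ≫ b) :=
            congrArg (fun x => (A.baseChange s).unitSection ≫ x) (D.sliceOver_snd b s hs)
      _ = ((A.baseChange s).unitSection ≫ pullback.snd A.X.hom s) ≫ b := (Category.assoc _ _ _).symm
      _ = 𝟙 _ ≫ b := by rw [hsec]
      _ = b := Category.id_comp _
      _ = b ≫ 𝟙 _ := (Category.comp_id _).symm
      _ = b ≫ (A.unitSlice D.hat ≫ pullback.snd A.X.hom D.hat.X.hom) :=
            congrArg (fun x => b ≫ x) (A.unitSlice_snd D.hat).symm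
      _ = (b ≫ A.unitSlice D.hat) ≫ pullback.snd A.X.hom D.hat.X.hom := (Category.assoc _ _ _).symm

/-- **The 𝒫-SLICE over a point `b : Spec Ω → Â` (base point `s`) as a rigidified line bundle on `A_s`**: `𝒫|_{A_s × {b}}`,
rank one (★ `hasRank_pullback`), rigidified along `ε_{A_s}` by the Poincaré normalisation `(ε_A × 1)^*𝒫 ≅ 𝒪_Â` pulled
back to the point.  (The test object of [MilneAV2008, I §8] that `b` itself classifies.) [cite: MilneAV2008, I §8 pp. 36–37]
[cite: MumfordFogartyKirwan1994, Ch. 6 §2 (pp. 120–121)] -/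
def sliceBundle (b : Spec (.of Ω) ⟶ D.hat.X.left) (s : Spec (.of Ω) ⟶ S) (hs : b ≫ D.hat.X.hom = s) :
    A.RigidifiedLineBundle s where
  L := (Scheme.Modules.pullback (D.sliceOver b s hs)).obj D.P
  hasRank_one := hasRank_pullback _ D.hasRank_one
  rigid := by
    obtain ⟨r⟩ := D.rigid
    refine ⟨(Scheme.Modules.pullbackComp _ _).app D.P ≪≫
      (Scheme.Modules.pullbackCongr (D.unitSection_baseChange_comp_sliceOver b s hs)).app D.P ≪≫
      ((Scheme.Modules.pullbackComp _ _).app D.P).symm ≪≫ (Scheme.Modules.pullback b).mapIso r ≪≫ ?_⟩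
    have hI : IsIso (SheafOfModules.pullbackObjUnitToUnit b.toRingCatSheafHom) := by
      haveI := Literature.AlgebraicGeometry.KTheory.final_opensMap b
      exact SheafOfModules.instIsIsoPullbackObjUnitToUnitOfFinal _
    exact @asIso _ _ _ _ (SheafOfModules.pullbackObjUnitToUnit b.toRingCatSheafHom) hI

/-- The module of the slice bundle. [cite: MilneAV2008, I §8 pp. 36–37] -/
@[simp] theorem sliceBundle_L (b : Spec (.of Ω) ⟶ D.hat.X.left) (s : Spec (.of Ω) ⟶ S) (hs : b ≫ D.hat.X.hom = s) :
    (D.sliceBundle b s hs).L = (Scheme.Modules.pullback (D.sliceOver b s hs)).obj D.P := rfl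

set_option maxHeartbeats 400000 in
/-- **The 𝒫-slice lies fibrewise in `Pic⁰`**: at every geometric point `t : Spec Ω′ → Spec Ω` the restriction of
`𝒫|_{A_s × {b}}` to `(A_s)_t` is translation-invariant — it is `𝒫|_{A_{t ≫ s} × {t ≫ b}}` transported along
`(A_s)_t ≅ A_{t ≫ s}` (B-p02's `fibreBaseChangeIso`, `isHomogeneous_pullback_iff_of_iso`), which is clause (a) of the dual
pair. [cite: MumfordAV1970, §8 ((iv) ⇔ (i))] [cite: MilneAV2008, I §8 pp. 36–37] -/
theorem sliceBundle_fibrewisePicZero (b : Spec (.of Ω) ⟶ D.hat.X.left) (s : Spec (.of Ω) ⟶ S)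
    (hs : b ≫ D.hat.X.hom = s) : (D.sliceBundle b s hs).FibrewisePicZero := by
  intro Ω' _ _ t
  have hs' : (t ≫ b) ≫ D.hat.X.hom = t ≫ s := by rw [Category.assoc, hs]
  have key := D.isHomogeneous_pullback_sliceOver (t ≫ b) hs'
  -- the comparison square between the two slices along `(A_s)_t ≅ A_{t ≫ s}`
  have hc : AbelianVariety.Hom.toSchemeHom (A.fibreBaseChangeIso s t).hom ≫ D.sliceOver (t ≫ b) (t ≫ s) hs' =
      pullback.fst (A.baseChange s).X.hom t ≫ D.sliceOver b s hs := by
    have hcond : pullback.fst (A.baseChange s).X.hom t ≫ pullback.snd A.X.hom s =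
        pullback.snd (A.baseChange s).X.hom t ≫ t := pullback.condition
    apply pullback.hom_ext
    · exact (Category.assoc _ _ _).trans
        ((congrArg (fun x => AbelianVariety.Hom.toSchemeHom (A.fibreBaseChangeIso s t).hom ≫ x)
            (D.sliceOver_fst (t ≫ b) (t ≫ s) hs')).trans
          ((fibreBaseChangeIso_hom_toSchemeHom_fst A s t).trans
            ((congrArg (fun x => pullback.fst (A.baseChange s).X.hom t ≫ x) (D.sliceOver_fst b s hs).symm).trans
              (Category.assoc _ _ _).symm)))
    · exact (Category.assoc _ _ _).trans
        ((congrArg (fun x => AbelianVariety.Hom.toSchemeHom (A.fibreBaseChangeIso s t).hom ≫ x)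
            (D.sliceOver_snd (t ≫ b) (t ≫ s) hs')).trans
          ((Category.assoc _ _ _).symm.trans
            ((congrArg (fun x => x ≫ (t ≫ b)) (fibreBaseChangeIso_hom_toSchemeHom_snd A s t)).trans
              ((Category.assoc _ _ _).symm.trans
                ((congrArg (fun x => x ≫ b) hcond.symm).trans
                  ((Category.assoc _ _ _).trans
                    ((congrArg (fun x => pullback.fst (A.baseChange s).X.hom t ≫ x)
                        (D.sliceOver_snd b s hs).symm).trans
                      (Category.assoc _ _ _).symm)))))))
  have h1 := (isHomogeneous_pullback_iff_of_iso (A.fibreBaseChangeIso s t) _).2 key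
  exact (isHomogeneous_iff_of_iso _ ((Scheme.Modules.pullbackComp _ _).app D.P ≪≫
    (Scheme.Modules.pullbackCongr hc).app D.P ≪≫ ((Scheme.Modules.pullbackComp _ _).app D.P).symm)).1 h1

/-- **(D-1′) THE DICTIONARY, uniqueness half: `λ̄₂(Q₂) = λ̄₁(Q₁)` iff the 𝒫-slices at the two values are isomorphic**
(«`b ↦ [𝒫|_{A_s × {b}}]` is injective», [MilneAV2008, I §8] uniqueness in the universal property, ★ `eq_of_nonempty_iso`,
with the slice itself as the test bundle).  With `IsLambdaOfAt` on both sides the slices are `t_Q^*𝒪(Θ) ⊗ 𝒪(Θ)⁻¹`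
(use `IsLambdaOfAt.nonempty_iso` to rewrite either side). [cite: MilneAV2008, I §8 pp. 36–37]
[cite: MumfordFogartyKirwan1994, Ch. 6 §2 Definition 6.2 (p. 120)] -/
theorem valueAt_eq_iff_nonempty_slice_iso (s : Spec (.of Ω) ⟶ S) (lam₁ lam₂ : A.X ⟶ D.hat.X)
    (Q₁ Q₂ : (A.fibre s).toAbelianVariety.Points Ω) :
    A.valueAt s D lam₂ Q₂ = A.valueAt s D lam₁ Q₁ ↔
      Nonempty ((Scheme.Modules.pullback (A.sliceAt s D lam₂ Q₂)).obj D.P ≅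
        (Scheme.Modules.pullback (A.sliceAt s D lam₁ Q₁)).obj D.P) := by
  constructor
  · intro h
    have hsl : A.sliceAt s D lam₂ Q₂ = A.sliceAt s D lam₁ Q₁ := by
      apply pullback.hom_ext
      · rw [sliceAt_fst, sliceAt_fst]
      · rw [sliceAt_snd, sliceAt_snd, h]
    exact ⟨(Scheme.Modules.pullbackCongr hsl).app D.P⟩
  · rintro ⟨e⟩
    exact D.eq_of_nonempty_iso s (D.sliceBundle (A.valueAt s D lam₁ Q₁) s (A.valueAt_comp_hom s D lam₁ Q₁))
      (D.sliceBundle_fibrewisePicZero _ s _) _ _ (A.valueAt_comp_hom s D lam₂ Q₂) (A.valueAt_comp_hom s D lam₁ Q₁)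
      ⟨e⟩ ⟨Iso.refl _⟩

/-- **(D-1) with the `Λ(𝒪(Θ))` witnesses read in**: `λ̄₂(Q₂) = λ̄₁(Q₁)` iff
`t_{Q₂}^*𝒪(Θ₂) ⊗ 𝒪(Θ₂)⁻¹ ≅ t_{Q₁}^*𝒪(Θ₁) ⊗ 𝒪(Θ₁)⁻¹`. [cite: MumfordFogartyKirwan1994, Ch. 6 §2 Definition 6.2 (p. 120)]
[cite: MilneAV2008, I §8 pp. 36–37] -/
theorem valueAt_eq_iff_nonempty_iso_of_isLambdaOfAt (s : Spec (.of Ω) ⟶ S) {lam₁ lam₂ : A.X ⟶ D.hat.X}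
    {Θ₁ Θ₂ : CartierDivisor (A.fibre s).toAbelianVariety.X.left}
    (h₁ : A.IsLambdaOfAt s D lam₁ Θ₁) (h₂ : A.IsLambdaOfAt s D lam₂ Θ₂)
    (Q₁ Q₂ : (A.fibre s).toAbelianVariety.Points Ω) :
    A.valueAt s D lam₂ Q₂ = A.valueAt s D lam₁ Q₁ ↔
      Nonempty (tensorObj
          ((Scheme.Modules.pullback ((A.fibre s).toAbelianVariety.translation Q₂).left).obj (A.lineBundleOfDivisor s Θ₂))
          (Modules.dual (A.lineBundleOfDivisor s Θ₂)) ≅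
        tensorObj
          ((Scheme.Modules.pullback ((A.fibre s).toAbelianVariety.translation Q₁).left).obj (A.lineBundleOfDivisor s Θ₁))
          (Modules.dual (A.lineBundleOfDivisor s Θ₁))) := by
  obtain ⟨i₁⟩ := AbelianSchemeOver.IsLambdaOfAt.nonempty_iso A s D lam₁ h₁ Q₁
  obtain ⟨i₂⟩ := AbelianSchemeOver.IsLambdaOfAt.nonempty_iso A s D lam₂ h₂ Q₂
  rw [D.valueAt_eq_iff_nonempty_slice_iso s lam₁ lam₂ Q₁ Q₂]
  exact ⟨fun ⟨e⟩ => ⟨i₂.symm ≪≫ e ≪≫ i₁⟩, fun ⟨e⟩ => ⟨i₂ ≪≫ e ≪≫ i₁.symm⟩⟩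

end DualPair

end AbelianSchemeOver

end Literature.AlgebraicGeometry.AbelianSchemes

end
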